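import Summits.Ventures.HodgeRepro.Tier4.Line1.KernelOperator
import Summits.Ventures.HodgeRepro.Tier4.Line1.KernelUnfold

/-!
# Tier4/Line1/KernelCompact — LINE L1, J1 rung (2) `kernelCLM_isCompactOperator` (t4-L1-p3)

Blind re-derivation cell `pub-hodge-repro`, Tier 4 (README §9–§10), seat t4-L1-p3.  The rung J1-(2) of the line's
skeleton (proofs/t4-plan-1/Tier4/Line1/Skeleton-v0.11.lean L586–L590) restated byte-identically and PROVED over every
`RTF.Setting G`: any bounded operator `T` on `L²(DG, μ)` that agrees a.e. with the kernel operator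
`(K_f ψ)(x) = ∫_{DG} K_f(x, z) ψ(z) dz` of a test function `f` (t4-L1-p1's `kernelOp`, `Tier4/Line1/KernelOperator.lean`)
is a COMPACT operator.

Proof (Mathlib only, no printed input) — finite-rank approximation in operator norm, not Arzelà–Ascoli (whose Mathlib
form wants a metric domain; `closure DG` is compact but `G` is not assumed Hausdorff or metrisable):
* (R1) `exists_open_kernel_close`: for `ε > 0` every `x` has an open neighbourhood `u` with
  `‖K_f(x', z) − K_f(x, z)‖ < ε` for all `x' ∈ u` and `z ∈ closure DG` (the tube lemma on `{x} ×ˢ closure DG`, joint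
  continuity of `K_f`); `exists_partition_kernel_close`: compactness of `closure DG` picks finitely many such
  neighbourhoods and `disjointed` turns them into a finite, measurable, pairwise disjoint cover `A i` of `closure DG`
  with base points `pt i`.
* (R2) the finite-rank operator `F ψ = ∑_i ⟪v i, ψ⟫ · 1_{A i}` with `v i = [conj K_f(pt i, ·)] ∈ L²(DG)` factors through
  `ℂ^n`, hence is compact (`isCompactOperator_of_locallyCompactSpace_rng`); `⟪v i, ψ⟫ = (K_f ψ)(pt i)`.
* (R3) for a.e. `x ∈ DG` (in exactly one `A i`), `(Tψ)(x) − (Fψ)(x) = ∫_{DG} (K_f(x, z) − K_f(pt i, z)) ψ(z) dz`, of norm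
  `≤ ε ∫_{DG} ‖ψ‖ ≤ ε · μ(DG)^{1/2} ‖ψ‖₂` (p1's `integral_norm_le_norm_Lp`), so `‖T − F‖ ≤ ε · μ(DG)` (`Lp.norm_le_of_ae_bound`,
  `opNorm_le_bound`).
* (R4) `ε` arbitrary ⟹ `T` lies in the closure of the compact operators, which is closed
  (`isClosed_setOf_isCompactOperator`).
`[SecondCountableTopology G]` is carried by the statement (it is what p1's `exists_kernelCLM` needs) and is not used here.

Nothing here says anything about the status of the Hodge conjecture for CM abelian varieties, which is NOT proved
(HC_CM is NOT proved by anyone in this repository).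
-/

set_option autoImplicit false

noncomputable section

namespace Summit.Ventures.HodgeRepro.Tier4.Line1.RTF.Setting

open MeasureTheory Topology Function
open scoped InnerProductSpace

/-- helper (proved): the a.e. representative of a finite sum in `L²` is the finite sum of the representatives. -/
theorem Lp_coeFn_finset_sum {α : Type} [MeasurableSpace α] {ν : Measure α} {ι : Type} (s : Finset ι)
    (g : ι → Lp ℂ 2 ν) : ⇑(∑ i ∈ s, g i) =ᵐ[ν] fun x => ∑ i ∈ s, g i x := by
  classical
  induction s using Finset.induction_on with
  | empty =>
    filter_upwards [Lp.coeFn_zero (E := ℂ) (p := 2) (μ := ν)] with x hx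
    simpa using hx
  | insert a s ha ih =>
    rw [Finset.sum_insert ha]
    filter_upwards [Lp.coeFn_add (g a) (∑ i ∈ s, g i), ih] with x h1 h2
    rw [h1, Pi.add_apply, h2, Finset.sum_insert ha]

variable {G : Type} [Group G] [TopologicalSpace G] [IsTopologicalGroup G] [MeasurableSpace G]
  [BorelSpace G]

variable (S : Setting G)

omit [BorelSpace G] in
/-- (R1) for `ε > 0`, every `x` has an open neighbourhood on which `K_f(·, z)` stays within `ε` of `K_f(x, z)`,
uniformly for `z ∈ closure DG` (the tube lemma on `{x} ×ˢ closure DG`). -/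
theorem exists_open_kernel_close {f : G → ℂ} (hf : IsTest f) {ε : ℝ} (hε : 0 < ε) (x : G) :
    ∃ u : Set G, IsOpen u ∧ x ∈ u ∧
      ∀ x' ∈ u, ∀ z ∈ closure S.DG, ‖S.kernel f x' z - S.kernel f x z‖ < ε := by
  have hK : Continuous fun p : G × G => S.kernel f p.1 p.2 := S.kernel_continuous hf
  have hK' : Continuous fun p : G × G => S.kernel f x p.2 :=
    hK.comp (continuous_const.prodMk continuous_snd)
  have hn : IsOpen {p : G × G | ‖S.kernel f p.1 p.2 - S.kernel f x p.2‖ < ε} :=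
    isOpen_lt (hK.sub hK').norm continuous_const
  have hsub : ({x} : Set G) ×ˢ closure S.DG ⊆
      {p : G × G | ‖S.kernel f p.1 p.2 - S.kernel f x p.2‖ < ε} := by
    rintro ⟨a, b⟩ ⟨ha, _⟩
    simp only [Set.mem_singleton_iff] at ha
    subst ha
    simpa using hε
  obtain ⟨u, v, hu, _, hxu, hLv, huv⟩ :=
    generalized_tube_lemma isCompact_singleton S.compG hn hsub
  refine ⟨u, hu, hxu rfl, fun x' hx' z hz => ?_⟩
  have h := huv (show (x', z) ∈ u ×ˢ v from ⟨hx', hLv hz⟩)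
  exact h

/-- (R1′) a finite measurable partition of `closure DG` on whose pieces the kernel is `ε`-constant in the first
variable: base points `pt i` and pairwise disjoint measurable sets `A i` covering `closure DG`. -/
theorem exists_partition_kernel_close {f : G → ℂ} (hf : IsTest f) {ε : ℝ} (hε : 0 < ε) :
    ∃ (n : ℕ) (pt : Fin n → G) (A : Fin n → Set G), (∀ i, MeasurableSet (A i)) ∧
      Pairwise (Disjoint on A) ∧ closure S.DG ⊆ ⋃ i, A i ∧
      ∀ i, ∀ x ∈ A i, ∀ z ∈ closure S.DG, ‖S.kernel f x z - S.kernel f (pt i) z‖ < ε := by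
  choose u hu using S.exists_open_kernel_close hf hε
  obtain ⟨t, ht⟩ := S.compG.elim_finite_subcover u (fun x => (hu x).1)
    (fun x _ => Set.mem_iUnion.mpr ⟨x, (hu x).2.1⟩)
  let e := t.equivFin
  let pt : Fin t.card → G := fun i => (e.symm i : G)
  let u' : ℕ → Set G := fun m => if h : m < t.card then u (pt ⟨m, h⟩) else ∅
  have hu'meas : ∀ m, MeasurableSet (u' m) := by
    intro m
    simp only [u']
    split_ifs
    · exact (hu _).1.measurableSet
    · exact MeasurableSet.empty
  have hdsub : ∀ i : Fin t.card, disjointed u' i.val ⊆ u (pt i) := by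
    intro i
    refine (disjointed_subset u' i.val).trans ?_
    simp only [u', dif_pos i.isLt, Fin.eta]
    exact le_rfl
  refine ⟨t.card, pt, fun i => disjointed u' i.val, fun i => MeasurableSet.disjointed hu'meas i.val,
    ?_, ?_, ?_⟩
  · intro i j hij
    exact disjoint_disjointed u' (Fin.val_injective.ne hij)
  · intro x hx
    obtain ⟨y, hyt, hxy⟩ := Set.mem_iUnion₂.mp (ht hx)
    have hxu' : x ∈ u' (e ⟨y, hyt⟩).val := by
      simp only [u', pt, dif_pos (e ⟨y, hyt⟩).isLt, Fin.eta, Equiv.symm_apply_apply]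
      exact hxy
    have hmem : x ∈ ⋃ m, disjointed u' m := by
      rw [iUnion_disjointed]
      exact Set.mem_iUnion.mpr ⟨_, hxu'⟩
    obtain ⟨m, hm⟩ := Set.mem_iUnion.mp hmem
    have hmlt : m < t.card := by
      by_contra hge
      have hx' := disjointed_subset u' m hm
      simp only [u', dif_neg hge] at hx'
      exact hx'
    exact Set.mem_iUnion.mpr ⟨⟨m, hmlt⟩, hm⟩
  · intro i x hx z hz
    exact (hu (pt i)).2.2 x (hdsub i hx) z hz

/-- (J1-(2), prover-facing, M–L): **it is a compact operator** — Arzelà–Ascoli on `closure DG` (`compG`): the image of the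
unit ball consists of functions equicontinuous and uniformly bounded by the uniform continuity of `K_f` on the compact
`closure DG × closure DG`; stated for ANY `T` agreeing a.e. with the kernel operator so that (1) and (2) compose without a
choice.  Rungs (3) (eigenvectors of `R(f̄ ⋆ f)` are continuous invariant functions) and (4) (the `G`-invariant
irreducible refinement = the declared wall) stay inside J1. -/
theorem kernelCLM_isCompactOperator [SecondCountableTopology G] {f : G → ℂ} (hf : IsTest f)
    (T : Lp ℂ 2 (S.μ.restrict S.DG) →L[ℂ] Lp ℂ 2 (S.μ.restrict S.DG))
    (hT : ∀ ψ : Lp ℂ 2 (S.μ.restrict S.DG), ⇑(T ψ) =ᵐ[S.μ.restrict S.DG] S.kernelOp f ⇑ψ) :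
    IsCompactOperator T := by
  haveI := S.haar
  haveI : IsFiniteMeasure (S.μ.restrict S.DG) := S.isFiniteMeasure_restrict_DG
  -- (R4) it suffices to approximate `T` in operator norm by compact operators
  have hclosed := isClosed_setOf_isCompactOperator (𝕜₁ := ℂ) (𝕜₂ := ℂ) (σ₁₂ := RingHom.id ℂ)
    (M₁ := Lp ℂ 2 (S.μ.restrict S.DG)) (M₂ := Lp ℂ 2 (S.μ.restrict S.DG))
  have hmem : T ∈ closure {F : Lp ℂ 2 (S.μ.restrict S.DG) →L[ℂ] Lp ℂ 2 (S.μ.restrict S.DG) |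
      IsCompactOperator F} := by
    rw [Metric.mem_closure_iff]
    intro δ hδ
    -- the constants
    set c₁ : ℝ := ((S.μ.restrict S.DG) Set.univ ^ (2⁻¹ : ℝ)).toReal with hc₁
    set c₂ : ℝ := ((measureUnivNNReal (S.μ.restrict S.DG) : ℝ) ^ (2⁻¹ : ℝ)) * c₁ with hc₂
    have hc₂0 : 0 ≤ c₂ := by positivity
    set ε : ℝ := δ / (2 * (c₂ + 1)) with hε
    have hε0 : 0 < ε := by positivity
    have hεc : ε * c₂ < δ := by
      rw [hε, div_mul_eq_mul_div, div_lt_iff₀ (by positivity)]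
      nlinarith
    -- (R1) the partition
    obtain ⟨n, pt, A, hAm, hAd, hAc, hAε⟩ := S.exists_partition_kernel_close hf hε0
    -- (R2) the finite-rank operator
    let v : Fin n → Lp ℂ 2 (S.μ.restrict S.DG) := fun i =>
      ((S.kernel_left_memLp hf (pt i)).star).toLp _
    have hv : ∀ i, ⇑(v i) =ᵐ[S.μ.restrict S.DG] fun w => starRingEnd ℂ (S.kernel f (pt i) w) :=
      fun i => MemLp.coeFn_toLp _
    let ind : Fin n → Lp ℂ 2 (S.μ.restrict S.DG) := fun i =>
      indicatorConstLp 2 (hAm i) (measure_ne_top _ (A i)) (1 : ℂ)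
    let P : Lp ℂ 2 (S.μ.restrict S.DG) →L[ℂ] (Fin n → ℂ) :=
      ContinuousLinearMap.pi (fun i => innerSL ℂ (v i))
    let J : (Fin n → ℂ) →L[ℂ] Lp ℂ 2 (S.μ.restrict S.DG) :=
      ∑ i, (ContinuousLinearMap.proj i).smulRight (ind i)
    let F := J.comp P
    have hFc : IsCompactOperator F :=
      (isCompactOperator_of_locallyCompactSpace_dom P).clm_comp J
    refine ⟨F, hFc, ?_⟩
    -- (R3) the bound `‖T - F‖ ≤ ε * c₂`
    have hF : ∀ ψ, F ψ = ∑ i, (⟪v i, ψ⟫_ℂ) • ind i := by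
      intro ψ
      simp only [F, J, P, ContinuousLinearMap.comp_apply, sum_apply, ContinuousLinearMap.smulRight_apply,
        ContinuousLinearMap.proj_apply, ContinuousLinearMap.pi_apply, innerSL_apply_apply]
    have hinner : ∀ i ψ, ⟪v i, ψ⟫_ℂ = S.kernelOp f ψ (pt i) := by
      intro i ψ
      rw [L2.inner_def]
      unfold kernelOp
      apply integral_congr_ae
      filter_upwards [hv i] with w hw
      rw [hw, RCLike.inner_apply, RCLike.conj_conj, mul_comm]
    have hbound : ∀ ψ, ‖(T - F) ψ‖ ≤ (ε * c₂) * ‖ψ‖ := by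
      intro ψ
      have hψint : Integrable (⇑ψ) (S.μ.restrict S.DG) := (Lp.memLp ψ).integrable one_le_two
      -- a.e. bound on the representative of `T ψ - F ψ`
      have hae : ∀ᵐ x ∂(S.μ.restrict S.DG), ‖((T - F) ψ) x‖ ≤ ε * c₁ * ‖ψ‖ := by
        have hFae : ⇑(F ψ) =ᵐ[S.μ.restrict S.DG] fun x => ∑ i, (⟪v i, ψ⟫_ℂ) * (A i).indicator (fun _ => (1 : ℂ)) x := by
          rw [hF]
          have h1 := Lp_coeFn_finset_sum (Finset.univ : Finset (Fin n)) (fun i => (⟪v i, ψ⟫_ℂ) • ind i)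
          have h2 : ∀ i, ⇑((⟪v i, ψ⟫_ℂ) • ind i) =ᵐ[S.μ.restrict S.DG]
              fun x => (⟪v i, ψ⟫_ℂ) * (A i).indicator (fun _ => (1 : ℂ)) x := by
            intro i
            filter_upwards [Lp.coeFn_smul (⟪v i, ψ⟫_ℂ) (ind i), indicatorConstLp_coeFn (p := 2) (hs := hAm i)
              (hμs := measure_ne_top _ (A i)) (c := (1 : ℂ))] with x hx1 hx2
            rw [hx1, Pi.smul_apply, smul_eq_mul]
            show (⟪v i, ψ⟫_ℂ) * (ind i) x = _
            rw [hx2]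
          have h3 : ∀ᵐ x ∂(S.μ.restrict S.DG), ∀ i, ((⟪v i, ψ⟫_ℂ) • ind i) x =
              (⟪v i, ψ⟫_ℂ) * (A i).indicator (fun _ => (1 : ℂ)) x := ae_all_iff.mpr h2
          filter_upwards [h1, h3] with x hx1 hx3
          rw [hx1]
          exact Finset.sum_congr rfl (fun i _ => hx3 i)
        filter_upwards [hT ψ, hFae, Lp.coeFn_sub (T ψ) (F ψ), ae_restrict_mem₀ S.fdG.nullMeasurableSet]
          with x hTx hFx hsub hxDG
        have hxL : x ∈ closure S.DG := subset_closure hxDG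
        obtain ⟨i₀, hi₀⟩ := Set.mem_iUnion.mp (hAc hxL)
        have hFx' : (F ψ) x = S.kernelOp f ψ (pt i₀) := by
          rw [hFx, Finset.sum_eq_single i₀]
          · rw [Set.indicator_of_mem hi₀, mul_one, hinner]
          · intro j _ hj
            rw [Set.indicator_of_notMem, mul_zero]
            exact fun hxj => Set.disjoint_left.mp (hAd hj) hxj hi₀
          · intro h
            exact absurd (Finset.mem_univ i₀) h
        rw [sub_apply, hsub, Pi.sub_apply, hTx, hFx']
        -- the difference is the integral of `(K(x,z) - K(pt i₀, z)) ψ z`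
        unfold kernelOp
        rw [← integral_sub (S.integrable_kernel_mul hf hψint x) (S.integrable_kernel_mul hf hψint (pt i₀))]
        have hpt : ∀ z, S.kernel f x z * ψ z - S.kernel f (pt i₀) z * ψ z =
            (S.kernel f x z - S.kernel f (pt i₀) z) * ψ z := fun z => (sub_mul _ _ _).symm
        simp_rw [hpt]
        calc ‖∫ z in S.DG, (S.kernel f x z - S.kernel f (pt i₀) z) * ψ z ∂S.μ‖
            ≤ ∫ z in S.DG, ε * ‖ψ z‖ ∂S.μ := by
              apply norm_integral_le_of_norm_le (hψint.norm.const_mul ε)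
              filter_upwards [ae_restrict_mem₀ S.fdG.nullMeasurableSet] with z hz
              rw [norm_mul]
              exact mul_le_mul_of_nonneg_right (le_of_lt (hAε i₀ x hi₀ z (subset_closure hz))) (norm_nonneg _)
          _ = ε * ∫ z in S.DG, ‖ψ z‖ ∂S.μ := integral_const_mul _ _
          _ ≤ ε * (c₁ * ‖ψ‖) := by
              apply mul_le_mul_of_nonneg_left _ hε0.le
              exact S.integral_norm_le_norm_Lp ψ
          _ = ε * c₁ * ‖ψ‖ := by ring
      have := Lp.norm_le_of_ae_bound (by positivity) hae
      calc ‖(T - F) ψ‖ ≤ (measureUnivNNReal (S.μ.restrict S.DG) : ℝ) ^ (2 : ENNReal).toReal⁻¹ * (ε * c₁ * ‖ψ‖) := this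
        _ = (ε * c₂) * ‖ψ‖ := by
            rw [hc₂]
            simp only [ENNReal.toReal_ofNat]
            ring
    have hop : ‖T - F‖ ≤ ε * c₂ := ContinuousLinearMap.opNorm_le_bound _ (by positivity) hbound
    rw [dist_eq_norm]
    exact lt_of_le_of_lt hop hεc
  rw [hclosed.closure_eq] at hmem
  exact hmem

end Summit.Ventures.HodgeRepro.Tier4.Line1.RTF.Setting
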